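import Mathlib.Algebra.Order.Star.Real
import Mathlib.Analysis.Matrix.Order
import Mathlib.Analysis.InnerProductSpace.PiL2
import Mathlib.Topology.Instances.Matrix
import HarnessLib

/-!
# ThreeScalePencil — the three-scale Schur-complement pencil of the lower-side IPM vs its few-squares preconditioner
(hubbard-algo crew (5), D-0042 R2(e): p1 TARGET.md §1 Thm M (ii)/(iii); source HOME/hubbard-algo-p1/lean/ThreeScalePencil.lean
v0.7c sha16 868f6e2366f80e16, landed by hubbard-algo-lit on p1's D59 request of 2026-08-25T18:56Z)

HONEST FRAMING: solver-side finite-dimensional linear algebra; this file has NO number and NO bound on any Hubbard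
quantity; the SIZE of the constants at the cell's optima is a measured (kit) datum, not a theorem.

**Structure (source).** Alizadeh–Haeberly–Overton, *SIAM J. Optim.* 8 (1998) 746 [AlizadehHaeberlyOverton1998], §4
(authors' offprint pp. 756–757): **Thm 4.1** — on the central path of an SDP whose solution satisfies the dual
nondegeneracy condition (3.2), `r = rank X`, `lim_{μ→0} μM^μ` exists and has rank `r̄² = r(r+1)/2` (`M^μ` the Schur
complement matrix); **Thm 4.2** — if moreover `m > r̄² > 0`, `cond(M^μ)` is bounded below by a positive constant times
`1/μ`; proof via
> `μM^μ = C_1^μD_1^μ(C_1^μ)ᵀ + C_2^μD_2^μ(C_2^μ)ᵀ + C_3^μD_3^μ(C_3^μ)ᵀ` **(4.3)**, `D^μ = Diag(λ_i^μλ_j^μ)` split by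
> `1 ≤ i ≤ j ≤ r` / `1 ≤ i ≤ r < j` / `r < i ≤ j`; "the norms of the second and third terms in (4.3) are `O(μ)` …
> Theorem 4.2 is easily extended to the block-diagonal case."

Under strict complementarity (`λ_i^μ = Θ(1)` for `i ≤ r`, `Θ(μ)` for `i > r`), (4.3)/`μ` has three parts of sizes
`μ⁻¹`, `1`, `μ` built on `μ`-free PSD matrices — the THREE-SCALE PENCIL `H(μ) = μ⁻¹H₋ + H₀ + μH₊` (`Hmu`) of this
file (the `μ`-dependence of AHO's `C_i^μ` frozen: the finite-dimensional shadow "at a centred point").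
**Preconditioner (source).** Toh–Kojima, *SIAM J. Optim.* 12 (2002) 669 [TohKojima2002]: the first spectral
preconditioner, built on the split of the scaling point into "two well-conditioned clusters `Λ = Θ(1/√μ)`,
`Λ⊥ = Θ(√μ)` (A0)"; "the empirical effectiveness was not rigorously guaranteed … It was informally argued in [45, 44]
that the assumption holds under strict complementarity and the primal-dual nondegeneracy of Alizadeh, Haeberly, and
Overton" — as restated in Chiu–Zhang, arXiv:2407.14013 [ChiuZhang2024] §1.1 p. 4. Here: `P(μ) = σ·1 + μ⁻¹H₋` (`Pmu`).

**What this file PROVES** (`H₋ H₀ H₊ : Matrix (Fin n) (Fin n) ℝ` PSD, `σ, μ₀ > 0`, `qf A v = vᵀAv`, face space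
`T_F = ker H₋ ∩ ker H₀` = `faceSpace`), uniformly in `μ ∈ (0, μ₀]`:
* `threeScale_upper` — (1) `vᵀH(μ)v ≤ C·vᵀP(μ)v` ∀`v`, explicit `C = 1 + (Σ|H₀ᵢⱼ| + μ₀Σ|H₊ᵢⱼ|)/σ` (uses `H₋ ⪰ 0` only);
* `threeScaleLower_holds` — (2) `c·vᵀP(μ)v ≤ vᵀH(μ)v` ∀`v ⟂ T_F`, SOME `μ`-free `c > 0` (non-effective: smallest
  positive "eigenvalue" of the comparison form `μ₀⁻¹H₋ + 2H₀` on `T_Fᗮ` by compactness, `exists_pos_lower_of_posSemidef`);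
* `threeScale_face` — (3) on `T_F`: `vᵀH(μ)v = μ·vᵀH₊v ≤ (Σ|H₊ᵢⱼ|)·μ·‖v‖²`;
* `threeScalePencil_holds` (package `ThreeScalePencil` = (1) ∧ (2) ∧ (3)), `structOneUniform_holds` (the `T_F = 0`
  corollary `StructOneUniform`: `P(μ)` alone is `μ`-uniformly spectrally equivalent to `H(μ)` — the Toh–Kojima regime);
* `hkm_eq_nt_BN/NN/BB`, `hkm_eq_nt_on_central_path` — on the central path the HKM and NT entry scalings agree on all
  three index classes (AHO98 p. 756: "On the central path, `X` and `Z` commute. … the Schur complement … is the same").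

Informal reading (Courant–Fischer, NOT formalised): all but `dim T_F` generalized eigenvalues of `(H(μ), P(μ))` lie in
`[c, C]`, the other `dim T_F` are `O(μ)`; `P(μ)` is `μ`-uniform iff `T_F = 0`, `P(μ)` + exact deflation of `T_F` always.
Scope (honest): elementary linear algebra about three FIXED PSD matrices; that an interior-point Schur complement HAS
this form is AHO98 (4.3) (central path, block-diagonal case) and is an INPUT, not a conclusion; nothing is claimed off the
path, about the `μ`-dependence of the `C_i^μ`, or about the SIZE of `c`. Clauses (1)–(3) are not printed in
[TohKojima2002]/[ChiuZhang2024] (whose guarantees need `T_F = 0`-type nondegeneracy, CZ24 Thm 3.3): they are the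
cell's own statements (hence `Summits/Ventures/…`, not `Literature/`); proofs reproduced from p1's file.
-/

noncomputable section
namespace Summit.Ventures.CertifiedManyBodySolver.HubbardAlg.KryIpm
open _root_.Matrix
variable {n : ℕ}

/-- The quadratic form `vᵀ A v` of a real square matrix. [folklore] -/
def qf (A : Matrix (Fin n) (Fin n) ℝ) (v : Fin n → ℝ) : ℝ := v ⬝ᵥ (A *ᵥ v)

/-- The three-scale pencil `H(μ) = μ⁻¹ H₋ + H₀ + μ H₊` — the shape of `M^μ = (4.3)/μ` on the central path.
[cite: AlizadehHaeberlyOverton1998, §4 eq. (4.3)] -/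
def Hmu (Hm H0 Hp : Matrix (Fin n) (Fin n) ℝ) (μ : ℝ) : Matrix (Fin n) (Fin n) ℝ := μ⁻¹ • Hm + H0 + μ • Hp

/-- The few-squares ("dominant cluster plus identity") preconditioner `P(μ) = σ·1 + μ⁻¹ H₋`.
[cite: TohKojima2002, two-cluster spectral preconditioner; restated in ChiuZhang2024 §1.1 (A0)] -/
def Pmu (Hm : Matrix (Fin n) (Fin n) ℝ) (σ μ : ℝ) : Matrix (Fin n) (Fin n) ℝ :=
  σ • (1 : Matrix (Fin n) (Fin n) ℝ) + μ⁻¹ • Hm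

/-- The face space `T_F = ker H₋ ∩ ker H₀` (the directions on which `H(μ) = μ H₊` is `O(μ)`). [folklore] -/
def faceSpace (Hm H0 : Matrix (Fin n) (Fin n) ℝ) : Set (Fin n → ℝ) := {v | Hm *ᵥ v = 0 ∧ H0 *ᵥ v = 0}

/-- **Three-scale pencil comparison** (hubbard-algo-p1 Thm M (ii)/(iii), typed): for PSD `H₋, H₀, H₊` and
`σ, μ₀ > 0` there are `μ`-free `c, C > 0`, `C₃ ≥ 0` with, for every `μ ∈ (0, μ₀]`,
(1) `vᵀH(μ)v ≤ C·vᵀP(μ)v` for all `v`; (2) `c·vᵀP(μ)v ≤ vᵀH(μ)v` for all `v ⟂ T_F`;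
(3) `vᵀH(μ)v ≤ C₃·μ·‖v‖²` on `T_F`.  Proved below: `threeScalePencil_holds`. [folklore] -/
def ThreeScalePencil : Prop :=
  ∀ (n : ℕ) (Hm H0 Hp : Matrix (Fin n) (Fin n) ℝ), Hm.PosSemidef → H0.PosSemidef → Hp.PosSemidef →
  ∀ σ μ₀ : ℝ, 0 < σ → 0 < μ₀ →
  ∃ c C C₃ : ℝ, 0 < c ∧ 0 < C ∧ 0 ≤ C₃ ∧ ∀ μ : ℝ, 0 < μ → μ ≤ μ₀ →
    (∀ v, qf (Hmu Hm H0 Hp μ) v ≤ C * qf (Pmu Hm σ μ) v) ∧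
    (∀ v, (∀ w ∈ faceSpace Hm H0, v ⬝ᵥ w = 0) → c * qf (Pmu Hm σ μ) v ≤ qf (Hmu Hm H0 Hp μ) v) ∧
    (∀ v ∈ faceSpace Hm H0, qf (Hmu Hm H0 Hp μ) v ≤ C₃ * μ * (v ⬝ᵥ v))

/-- The face-free (`T_F = 0`) corollary shape: `P(μ)` alone is `μ`-uniformly spectrally equivalent to `H(μ)` —
the situation Toh–Kojima argue for under strict complementarity + AHO primal–dual nondegeneracy.  Proved below:
`structOneUniform_holds`. [cite: TohKojima2002, as restated in ChiuZhang2024 §1.1 ("informally argued in [45, 44]")] -/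
def StructOneUniform : Prop :=
  ∀ (n : ℕ) (Hm H0 Hp : Matrix (Fin n) (Fin n) ℝ), Hm.PosSemidef → H0.PosSemidef → Hp.PosSemidef →
  faceSpace Hm H0 = {0} →
  ∀ σ μ₀ : ℝ, 0 < σ → 0 < μ₀ →
  ∃ c C : ℝ, 0 < c ∧ 0 < C ∧ ∀ μ : ℝ, 0 < μ → μ ≤ μ₀ →
    ∀ v, c * qf (Pmu Hm σ μ) v ≤ qf (Hmu Hm H0 Hp μ) v ∧ qf (Hmu Hm H0 Hp μ) v ≤ C * qf (Pmu Hm σ μ) v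

/-- Glue: the face-free case follows from the general statement (clause (2) then applies to every `v`). [folklore] -/
theorem structOneUniform_of_threeScalePencil (h : ThreeScalePencil) : StructOneUniform := by
  intro n Hm H0 Hp hm h0 hp hT σ μ₀ hσ hμ₀
  obtain ⟨c, C, C₃, hc, hC, _, hall⟩ := h n Hm H0 Hp hm h0 hp σ μ₀ hσ hμ₀
  refine ⟨c, C, hc, hC, fun μ hμ hμle v => ?_⟩
  obtain ⟨h1, h2, _⟩ := hall μ hμ hμle
  refine ⟨h2 v fun w hw => ?_, h1 v⟩
  rw [hT] at hw
  simp [Set.mem_singleton_iff.mp hw]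

/-- On the face space the pencil numerator is exactly the `μ H₊` part. [folklore] -/
theorem qf_Hmu_of_mem_faceSpace (Hm H0 Hp : Matrix (Fin n) (Fin n) ℝ) (μ : ℝ) (v : Fin n → ℝ)
    (hv : v ∈ faceSpace Hm H0) : qf (Hmu Hm H0 Hp μ) v = μ * qf Hp v := by
  obtain ⟨h1, h2⟩ := hv
  simp only [qf, Hmu, add_mulVec, smul_mulVec, h1, h2, smul_zero, zero_add, add_zero, dotProduct_smul,
    smul_eq_mul]

/-! ### Clauses (1) and (3), with explicit constants -/

/-- `Σ_{ij} |A i j|` — a crude, hypothesis-free bound for the operator norm. [folklore] -/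
def sumAbs (A : Matrix (Fin n) (Fin n) ℝ) : ℝ := ∑ i, ∑ j, |A i j|

/-- `0 ≤ Σ|Aᵢⱼ|`. [folklore] -/
theorem sumAbs_nonneg (A : Matrix (Fin n) (Fin n) ℝ) : 0 ≤ sumAbs A :=
  Finset.sum_nonneg (fun _ _ => Finset.sum_nonneg (fun _ _ => abs_nonneg _))

/-- `vᵢ² ≤ ‖v‖²`. [folklore] -/
theorem sq_le_dot (v : Fin n → ℝ) (i : Fin n) : v i * v i ≤ v ⬝ᵥ v := by
  unfold dotProduct
  exact Finset.single_le_sum (f := fun k => v k * v k) (fun k _ => mul_self_nonneg (v k)) (Finset.mem_univ i)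

/-- `|vᵢ| |vⱼ| ≤ ‖v‖²`. [folklore] -/
theorem abs_mul_abs_le_dot (v : Fin n → ℝ) (i j : Fin n) : |v i| * |v j| ≤ v ⬝ᵥ v := by
  have h3 : 2 * (|v i| * |v j|) ≤ v i * v i + v j * v j := by
    simpa [sq, abs_mul_abs_self, mul_assoc] using two_mul_le_add_sq (|v i|) (|v j|)
  nlinarith [abs_nonneg (v i), abs_nonneg (v j), sq_le_dot v i, sq_le_dot v j]

/-- Elementwise bound `vᵀ A v ≤ (Σ |A i j|) · ‖v‖²` (no PSD hypothesis). [folklore] -/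
theorem qf_le_sumAbs_mul_dot (A : Matrix (Fin n) (Fin n) ℝ) (v : Fin n → ℝ) :
    qf A v ≤ sumAbs A * (v ⬝ᵥ v) := by
  unfold qf sumAbs
  have hexp : v ⬝ᵥ (A *ᵥ v) = ∑ i, ∑ j, A i j * (v i * v j) := by
    simp only [dotProduct, mulVec, Finset.mul_sum]
    refine Finset.sum_congr rfl (fun i _ => Finset.sum_congr rfl (fun j _ => by ring))
  rw [hexp, Finset.sum_mul]
  refine Finset.sum_le_sum (fun i _ => ?_)
  rw [Finset.sum_mul]
  refine Finset.sum_le_sum (fun j _ => ?_)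
  calc A i j * (v i * v j) ≤ |A i j * (v i * v j)| := le_abs_self _
    _ = |A i j| * (|v i| * |v j|) := by rw [abs_mul, abs_mul]
    _ ≤ |A i j| * (v ⬝ᵥ v) := by
        exact mul_le_mul_of_nonneg_left (abs_mul_abs_le_dot v i j) (abs_nonneg _)

/-- `vᵀH(μ)v = μ⁻¹ vᵀH₋v + vᵀH₀v + μ vᵀH₊v`. [folklore] -/
theorem qf_Hmu_expand (Hm H0 Hp : Matrix (Fin n) (Fin n) ℝ) (μ : ℝ) (v : Fin n → ℝ) :
    qf (Hmu Hm H0 Hp μ) v = μ⁻¹ * qf Hm v + qf H0 v + μ * qf Hp v := by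
  simp only [qf, Hmu, add_mulVec, smul_mulVec, dotProduct_add, dotProduct_smul, smul_eq_mul]

/-- `vᵀP(μ)v = σ‖v‖² + μ⁻¹ vᵀH₋v`. [folklore] -/
theorem qf_Pmu_expand (Hm : Matrix (Fin n) (Fin n) ℝ) (σ μ : ℝ) (v : Fin n → ℝ) :
    qf (Pmu Hm σ μ) v = σ * (v ⬝ᵥ v) + μ⁻¹ * qf Hm v := by
  simp only [qf, Pmu, add_mulVec, smul_mulVec, one_mulVec, dotProduct_add, dotProduct_smul, smul_eq_mul]

/-- A PSD form is nonnegative. [folklore] -/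
theorem qf_nonneg_of_posSemidef {A : Matrix (Fin n) (Fin n) ℝ} (hA : A.PosSemidef) (v : Fin n → ℝ) :
    0 ≤ qf A v := by simpa [qf] using hA.dotProduct_mulVec_nonneg v

/-- **Clause (1)**: `vᵀH(μ)v ≤ C · vᵀP(μ)v` for all `v` and `μ ∈ (0, μ₀]`, with the explicit `μ`-free
`C = 1 + (sumAbs H₀ + μ₀ · sumAbs H₊)/σ`; only `H₋ ⪰ 0` is used. [folklore] -/
theorem threeScale_upper {Hm : Matrix (Fin n) (Fin n) ℝ} (H0 Hp : Matrix (Fin n) (Fin n) ℝ)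
    (hm : Hm.PosSemidef) {σ μ₀ μ : ℝ} (hσ : 0 < σ) (hμ : 0 < μ) (hμle : μ ≤ μ₀) (v : Fin n → ℝ) :
    qf (Hmu Hm H0 Hp μ) v ≤ (1 + (sumAbs H0 + μ₀ * sumAbs Hp) / σ) * qf (Pmu Hm σ μ) v := by
  rw [qf_Hmu_expand, qf_Pmu_expand]
  have h0 := qf_le_sumAbs_mul_dot H0 v
  have hp := qf_le_sumAbs_mul_dot Hp v
  have hmv := qf_nonneg_of_posSemidef hm v
  have hvv : 0 ≤ v ⬝ᵥ v := Finset.sum_nonneg fun k _ => mul_self_nonneg (v k)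
  have hS0 := sumAbs_nonneg H0
  have hSp := sumAbs_nonneg Hp
  have hμinv : 0 ≤ μ⁻¹ := le_of_lt (inv_pos.mpr hμ)
  have hp' : μ * qf Hp v ≤ μ₀ * sumAbs Hp * (v ⬝ᵥ v) := by
    calc μ * qf Hp v ≤ μ * (sumAbs Hp * (v ⬝ᵥ v)) := mul_le_mul_of_nonneg_left hp (le_of_lt hμ)
      _ ≤ μ₀ * (sumAbs Hp * (v ⬝ᵥ v)) := mul_le_mul_of_nonneg_right hμle (mul_nonneg hSp hvv)
      _ = μ₀ * sumAbs Hp * (v ⬝ᵥ v) := by ring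
  have key : (sumAbs H0 + μ₀ * sumAbs Hp) * (v ⬝ᵥ v)
      = ((sumAbs H0 + μ₀ * sumAbs Hp) / σ) * (σ * (v ⬝ᵥ v)) := by
    field_simp
  have hK : 0 ≤ (sumAbs H0 + μ₀ * sumAbs Hp) / σ :=
    div_nonneg (add_nonneg hS0 (mul_nonneg (le_trans (le_of_lt hμ) hμle) hSp)) (le_of_lt hσ)
  nlinarith [mul_nonneg hK (mul_nonneg hμinv hmv), mul_nonneg (le_of_lt hσ) hvv, mul_nonneg hμinv hmv]

/-- **Clause (3)**: on the face space `T_F`, `vᵀH(μ)v = μ · vᵀH₊v ≤ sumAbs H₊ · μ · ‖v‖²`. [folklore] -/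
theorem threeScale_face {Hm H0 : Matrix (Fin n) (Fin n) ℝ} (Hp : Matrix (Fin n) (Fin n) ℝ) {μ : ℝ}
    (hμ : 0 < μ) (v : Fin n → ℝ) (hv : v ∈ faceSpace Hm H0) :
    qf (Hmu Hm H0 Hp μ) v ≤ sumAbs Hp * μ * (v ⬝ᵥ v) := by
  rw [qf_Hmu_of_mem_faceSpace Hm H0 Hp μ v hv]
  nlinarith [mul_le_mul_of_nonneg_left (qf_le_sumAbs_mul_dot Hp v) (le_of_lt hμ)]

/-- Clause (2) as a stand-alone statement: the lower bound on `T_Fᗮ` with SOME `μ`-free `c > 0`.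
Proved below: `threeScaleLower_holds`. [folklore] -/
def ThreeScaleLower : Prop :=
  ∀ (n : ℕ) (Hm H0 Hp : Matrix (Fin n) (Fin n) ℝ), Hm.PosSemidef → H0.PosSemidef → Hp.PosSemidef →
  ∀ σ μ₀ : ℝ, 0 < σ → 0 < μ₀ →
  ∃ c : ℝ, 0 < c ∧ ∀ μ : ℝ, 0 < μ → μ ≤ μ₀ →
    ∀ v, (∀ w ∈ faceSpace Hm H0, v ⬝ᵥ w = 0) → c * qf (Pmu Hm σ μ) v ≤ qf (Hmu Hm H0 Hp μ) v

/-- Reduction: clause (2) implies the whole package, clauses (1) and (3) being `threeScale_upper` /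
`threeScale_face` with their explicit constants. [folklore] -/
theorem threeScalePencil_of_lower (h : ThreeScaleLower) : ThreeScalePencil := by
  intro n Hm H0 Hp hm h0 hp σ μ₀ hσ hμ₀
  obtain ⟨c, hc, hlow⟩ := h n Hm H0 Hp hm h0 hp σ μ₀ hσ hμ₀
  refine ⟨c, 1 + (sumAbs H0 + μ₀ * sumAbs Hp) / σ, sumAbs Hp, hc, ?_, sumAbs_nonneg Hp,
    fun μ hμ hμle => ?_⟩
  · have : 0 ≤ (sumAbs H0 + μ₀ * sumAbs Hp) / σ :=
      div_nonneg (add_nonneg (sumAbs_nonneg H0) (mul_nonneg (le_of_lt hμ₀) (sumAbs_nonneg Hp))) (le_of_lt hσ)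
    linarith
  refine ⟨fun v => threeScale_upper H0 Hp hm hσ hμ hμle v, fun v hv => hlow μ hμ hμle v hv, fun v hv => ?_⟩
  exact threeScale_face Hp hμ v hv

/-! ### Clause (2): the lower bound on `T_Fᗮ`, by compactness of the unit sphere -/

/-- `qf A (a • v) = a² · qf A v`. [folklore] -/
theorem qf_smul (A : Matrix (Fin n) (Fin n) ℝ) (a : ℝ) (v : Fin n → ℝ) :
    qf A (a • v) = a * a * qf A v := by
  simp only [qf, mulVec_smul, dotProduct_smul, smul_dotProduct, smul_eq_mul]
  ring

/-- For PSD `A`: `vᵀAv = 0 ↔ Av = 0`. [folklore] -/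
theorem qf_eq_zero_iff_of_posSemidef {A : Matrix (Fin n) (Fin n) ℝ} (hA : A.PosSemidef) (v : Fin n → ℝ) :
    qf A v = 0 ↔ A *ᵥ v = 0 := by simpa [qf] using hA.dotProduct_mulVec_zero_iff v

/-- `v ↦ vᵀAv` is continuous. [folklore] -/
theorem continuous_qf (A : Matrix (Fin n) (Fin n) ℝ) : Continuous fun v : Fin n → ℝ => qf A v :=
  continuous_id.dotProduct (continuous_const.matrix_mulVec continuous_id)

/-- Unit vectors orthogonal to `ker K`. [folklore] -/
def spherePerp (K : Matrix (Fin n) (Fin n) ℝ) : Set (Fin n → ℝ) :=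
  {v | v ⬝ᵥ v = 1 ∧ ∀ w, K *ᵥ w = 0 → v ⬝ᵥ w = 0}

/-- `spherePerp K` is compact (closed and bounded in the sup norm). [folklore] -/
theorem isCompact_spherePerp (K : Matrix (Fin n) (Fin n) ℝ) : IsCompact (spherePerp K) := by
  apply Metric.isCompact_of_isClosed_isBounded
  · apply IsClosed.inter
    · exact isClosed_eq (continuous_id.dotProduct continuous_id) continuous_const
    · have : {v : Fin n → ℝ | ∀ w, K *ᵥ w = 0 → v ⬝ᵥ w = 0}
          = ⋂ (w : Fin n → ℝ) (_ : K *ᵥ w = 0), {v | v ⬝ᵥ w = 0} := by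
        ext v; simp
      show IsClosed {v : Fin n → ℝ | ∀ w, K *ᵥ w = 0 → v ⬝ᵥ w = 0}
      rw [this]
      exact isClosed_iInter fun w => isClosed_iInter fun _ =>
        isClosed_eq (continuous_id.dotProduct continuous_const) continuous_const
  · rw [Metric.isBounded_iff_subset_closedBall (0 : Fin n → ℝ)]
    refine ⟨1, fun v hv => ?_⟩
    rw [mem_closedBall_zero_iff, pi_norm_le_iff_of_nonneg zero_le_one]
    intro i
    rw [Real.norm_eq_abs, abs_le_one_iff_mul_self_le_one, ← hv.1]
    exact sq_le_dot v i

/-- Rescaling a nonzero vector orthogonal to `ker K` into `spherePerp K`. [folklore] -/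
theorem rescale_mem_spherePerp (K : Matrix (Fin n) (Fin n) ℝ) (v : Fin n → ℝ)
    (hv : ∀ w, K *ᵥ w = 0 → v ⬝ᵥ w = 0) (hne : v ⬝ᵥ v ≠ 0) :
    ∃ a : ℝ, 0 < a ∧ a * a * (v ⬝ᵥ v) = 1 ∧ a • v ∈ spherePerp K := by
  have hpos : 0 < v ⬝ᵥ v := lt_of_le_of_ne (Finset.sum_nonneg fun k _ => mul_self_nonneg (v k)) (Ne.symm hne)
  have hs : Real.sqrt (v ⬝ᵥ v) * Real.sqrt (v ⬝ᵥ v) = v ⬝ᵥ v := Real.mul_self_sqrt hpos.le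
  have hsr : Real.sqrt (v ⬝ᵥ v) ≠ 0 := (Real.sqrt_pos.mpr hpos).ne'
  have haa : (Real.sqrt (v ⬝ᵥ v))⁻¹ * (Real.sqrt (v ⬝ᵥ v))⁻¹ * (v ⬝ᵥ v) = 1 := by
    have h1 : (Real.sqrt (v ⬝ᵥ v))⁻¹ * (Real.sqrt (v ⬝ᵥ v))⁻¹ * (Real.sqrt (v ⬝ᵥ v) * Real.sqrt (v ⬝ᵥ v)) = 1 := by
      field_simp
    rwa [hs] at h1
  refine ⟨(Real.sqrt (v ⬝ᵥ v))⁻¹, by positivity, haa, ?_, ?_⟩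
  · rw [smul_dotProduct, dotProduct_smul, smul_eq_mul, smul_eq_mul, ← mul_assoc, haa]
  · intro w hw
    rw [smul_dotProduct, hv w hw, smul_zero]

/-- KEY: a positive semidefinite form is bounded below by a positive multiple of `‖v‖²` on the vectors orthogonal
to its kernel (its smallest positive eigenvalue; obtained here by minimising over the compact `spherePerp K`,
so the constant is non-effective). [folklore] -/
theorem exists_pos_lower_of_posSemidef {K : Matrix (Fin n) (Fin n) ℝ} (hK : K.PosSemidef) :
    ∃ lam : ℝ, 0 < lam ∧ ∀ v : Fin n → ℝ, (∀ w, K *ᵥ w = 0 → v ⬝ᵥ w = 0) → lam * (v ⬝ᵥ v) ≤ qf K v := by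
  by_cases hne : (spherePerp K).Nonempty
  · obtain ⟨v₀, hv₀S, hmin⟩ :=
      (isCompact_spherePerp K).exists_isMinOn hne (continuous_qf K).continuousOn
    have hge : ∀ u ∈ spherePerp K, qf K v₀ ≤ qf K u := fun u hu => (isMinOn_iff.mp hmin) u hu
    have hpos : 0 < qf K v₀ := by
      rcases (qf_nonneg_of_posSemidef hK v₀).lt_or_eq with h | h
      · exact h
      · exfalso
        have hK0 : K *ᵥ v₀ = 0 := (qf_eq_zero_iff_of_posSemidef hK v₀).mp h.symm
        have h1 : v₀ ⬝ᵥ v₀ = 0 := hv₀S.2 v₀ hK0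
        have h2 : v₀ ⬝ᵥ v₀ = 1 := hv₀S.1
        linarith
    refine ⟨qf K v₀, hpos, fun v hv => ?_⟩
    by_cases hv0 : v ⬝ᵥ v = 0
    · have : v = 0 := dotProduct_self_eq_zero.mp hv0
      subst this
      simp [qf]
    · obtain ⟨a, _, haa, haS⟩ := rescale_mem_spherePerp K v hv hv0
      have h1 := hge _ haS
      rw [qf_smul] at h1
      have hr : 0 ≤ v ⬝ᵥ v := Finset.sum_nonneg fun k _ => mul_self_nonneg (v k)
      calc qf K v₀ * (v ⬝ᵥ v) ≤ a * a * qf K v * (v ⬝ᵥ v) := mul_le_mul_of_nonneg_right h1 hr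
        _ = qf K v * (a * a * (v ⬝ᵥ v)) := by ring
        _ = qf K v := by rw [haa, mul_one]
  · refine ⟨1, one_pos, fun v hv => ?_⟩
    by_cases hv0 : v ⬝ᵥ v = 0
    · have : v = 0 := dotProduct_self_eq_zero.mp hv0
      subst this
      simp [qf]
    · obtain ⟨a, _, _, haS⟩ := rescale_mem_spherePerp K v hv hv0
      exact absurd ⟨_, haS⟩ hne

/-- **Clause (2)**: PROVED, via the comparison form `K = μ₀⁻¹H₋ + 2H₀` (PSD, kernel inside `T_F`) and
`exists_pos_lower_of_posSemidef`; the constant is `min (1/2) (λ/(2σ))`. [folklore] -/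
theorem threeScaleLower_holds : ThreeScaleLower := by
  intro n Hm H0 Hp hm h0 hp σ μ₀ hσ hμ₀
  have hK : (μ₀⁻¹ • Hm + (2 : ℝ) • H0).PosSemidef :=
    (hm.smul (inv_nonneg.mpr hμ₀.le)).add (h0.smul (by norm_num : (0 : ℝ) ≤ 2))
  have hexpK : ∀ w, qf (μ₀⁻¹ • Hm + (2 : ℝ) • H0) w = μ₀⁻¹ * qf Hm w + 2 * qf H0 w := fun w => by
    simp only [qf, add_mulVec, smul_mulVec, dotProduct_add, dotProduct_smul, smul_eq_mul]
  have hker : ∀ w, (μ₀⁻¹ • Hm + (2 : ℝ) • H0) *ᵥ w = 0 → w ∈ faceSpace Hm H0 := by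
    intro w hw
    have hq : qf (μ₀⁻¹ • Hm + (2 : ℝ) • H0) w = 0 := by simp [qf, hw]
    have h2 := qf_nonneg_of_posSemidef h0 w
    have h3 : 0 ≤ μ₀⁻¹ * qf Hm w := mul_nonneg (inv_nonneg.mpr hμ₀.le) (qf_nonneg_of_posSemidef hm w)
    have h4 : μ₀⁻¹ * qf Hm w = 0 := by linarith [hexpK w]
    have hm0 : qf Hm w = 0 := (mul_eq_zero.mp h4).resolve_left (inv_ne_zero hμ₀.ne')
    have h00 : qf H0 w = 0 := by linarith [hexpK w]
    exact ⟨(qf_eq_zero_iff_of_posSemidef hm w).mp hm0, (qf_eq_zero_iff_of_posSemidef h0 w).mp h00⟩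
  obtain ⟨lam, hlam, hlow⟩ := exists_pos_lower_of_posSemidef hK
  refine ⟨min (1 / 2) (lam / (2 * σ)), lt_min one_half_pos (div_pos hlam (by positivity)), ?_⟩
  intro μ hμ hμle v hv
  have hkey := hlow v (fun w hw => hv w (hker w hw))
  rw [hexpK] at hkey
  rw [qf_Pmu_expand, qf_Hmu_expand]
  have hr : 0 ≤ v ⬝ᵥ v := Finset.sum_nonneg fun k _ => mul_self_nonneg (v k)
  have hmv : 0 ≤ qf Hm v := qf_nonneg_of_posSemidef hm v
  have h0v : 0 ≤ qf H0 v := qf_nonneg_of_posSemidef h0 v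
  have hpv : 0 ≤ μ * qf Hp v := mul_nonneg hμ.le (qf_nonneg_of_posSemidef hp v)
  have hc1 : min (1 / 2) (lam / (2 * σ)) ≤ 1 / 2 := min_le_left _ _
  have hc2 : min (1 / 2) (lam / (2 * σ)) * (2 * σ) ≤ lam :=
    (le_div_iff₀ (by positivity)).mp (min_le_right _ _)
  have hinv : μ₀⁻¹ ≤ μ⁻¹ := by
    rw [inv_le_inv₀ hμ₀ hμ]; exact hμle
  have f1 : min (1 / 2) (lam / (2 * σ)) * (2 * σ) * (v ⬝ᵥ v) ≤ lam * (v ⬝ᵥ v) :=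
    mul_le_mul_of_nonneg_right hc2 hr
  have f3 : μ₀⁻¹ * qf Hm v ≤ μ⁻¹ * qf Hm v := mul_le_mul_of_nonneg_right hinv hmv
  have f4 : min (1 / 2) (lam / (2 * σ)) * (μ⁻¹ * qf Hm v) ≤ 1 / 2 * (μ⁻¹ * qf Hm v) :=
    mul_le_mul_of_nonneg_right hc1 (mul_nonneg (inv_nonneg.mpr hμ.le) hmv)
  nlinarith [f1, f3, f4, hkey, hpv, h0v]

/-- **Thm M (ii)/(iii): all three clauses** — PROVED. [folklore] -/
theorem threeScalePencil_holds : ThreeScalePencil := threeScalePencil_of_lower threeScaleLower_holds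

/-- The face-free (Toh–Kojima) corollary — PROVED. [folklore] -/
theorem structOneUniform_holds : StructOneUniform :=
  structOneUniform_of_threeScalePencil threeScalePencil_holds

/-! ### Kernel dictionary: HKM ≡ NT on the central path
In the common eigenbasis of a centred pair (`x̃ᵢs̃ᵢ = μ`; B-directions `s̃ = m`, `x̃ = μ/m`; N-directions `x̃ = g`,
`s̃ = μ/g`) the HKM scaling of a matrix unit `E_ij` is `(x̃ᵢ/s̃ⱼ + x̃ⱼ/s̃ᵢ)/2`, the NT one `wᵢ⁻¹wⱼ⁻¹` with
`w⁻¹ = √μ/m` (B) / `g/√μ` (N); they agree class by class, so the pencil idealises both kernels ON the path. -/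

/-- BN class: HKM `((μ/m)/(μ/g) + g/m)/2` = NT `(√μ/m)(g/√μ)` (both `= g/m`).
[cite: AlizadehHaeberlyOverton1998, §4 p. 756 (central path: all methods give the same `M`)] -/
theorem hkm_eq_nt_BN {μ m g : ℝ} (hμ : 0 < μ) (hm : 0 < m) (hg : 0 < g) :
    ((μ / m) / (μ / g) + g / m) / 2 = (Real.sqrt μ / m) * (g / Real.sqrt μ) := by
  have hs : Real.sqrt μ ≠ 0 := (Real.sqrt_pos.mpr hμ).ne'
  rw [show (Real.sqrt μ / m) * (g / Real.sqrt μ) = g / m by field_simp]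
  field_simp
  ring

/-- NN class: HKM `(g/(μ/g') + g'/(μ/g))/2` = NT `(g/√μ)(g'/√μ)` (both `= gg'/μ`).
[cite: AlizadehHaeberlyOverton1998, §4 p. 756] -/
theorem hkm_eq_nt_NN {μ g g' : ℝ} (hμ : 0 < μ) :
    (g / (μ / g') + g' / (μ / g)) / 2 = (g / Real.sqrt μ) * (g' / Real.sqrt μ) := by
  have hs : Real.sqrt μ * Real.sqrt μ = μ := Real.mul_self_sqrt (le_of_lt hμ)
  rw [div_mul_div_comm, hs]
  field_simp
  ring

/-- BB class: HKM `((μ/m)/m' + (μ/m')/m)/2` = NT `(√μ/m)(√μ/m')` (both `= μ/(mm')`).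
[cite: AlizadehHaeberlyOverton1998, §4 p. 756] -/
theorem hkm_eq_nt_BB {μ m m' : ℝ} (hμ : 0 < μ) (hm : 0 < m) (hm' : 0 < m') :
    ((μ / m) / m' + (μ / m') / m) / 2 = (Real.sqrt μ / m) * (Real.sqrt μ / m') := by
  have hs : Real.sqrt μ * Real.sqrt μ = μ := Real.mul_self_sqrt (le_of_lt hμ)
  rw [div_mul_div_comm, hs]
  field_simp
  ring

/-- The dictionary in one statement: on the central path the HKM and NT Schur scalings coincide on all three index
classes (`μ, m, m', g > 0`). [cite: AlizadehHaeberlyOverton1998, §4 p. 756] -/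
theorem hkm_eq_nt_on_central_path {μ m m' g g' : ℝ} (hμ : 0 < μ) (hm : 0 < m) (hm' : 0 < m') (hg : 0 < g) :
    ((μ / m) / (μ / g) + g / m) / 2 = (Real.sqrt μ / m) * (g / Real.sqrt μ) ∧
    (g / (μ / g') + g' / (μ / g)) / 2 = (g / Real.sqrt μ) * (g' / Real.sqrt μ) ∧
    ((μ / m) / m' + (μ / m') / m) / 2 = (Real.sqrt μ / m) * (Real.sqrt μ / m') :=
  ⟨hkm_eq_nt_BN hμ hm hg, hkm_eq_nt_NN hμ, hkm_eq_nt_BB hμ hm hm'⟩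

end Summit.Ventures.CertifiedManyBodySolver.HubbardAlg.KryIpm

end
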